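import Literature.NumberTheory.Automorphic.IdeleClassGroupFirstCohomologyAll
import Literature.NumberTheory.Automorphic.ExistsClassFieldCharacterHolds
import HarnessLib

/-!
# `Ĥ⁰(Gal(E/F), C_E)` on idele classes: the fixed classes are `ι(C_F)` and the norm classes have index
# `[E : F]` in them (Tate, Cassels–Fröhlich Ch. VII §5.1 (B), §8 Prop. 8.1, §9 Thm. 9.1 — the `Ĥ⁰` datum of
# the global class formation)

Topic `NumberTheory/Automorphic` (ideles, idele classes); namespace
`Literature.NumberTheory.Automorphic.IdeleClassGroup`.  Proof file: theorems only (no definition, no named fact,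
no instance; D-0026).  Sequel to `IdeleClassGroupFirstCohomology*` (axiom I, `H¹(Gal(E/F), C_E) = 0`).

For a finite Galois extension of number fields `E/F` with group `G`, acting on `C_E = 𝕀_E/Eˣ` by `classGalAct`:

* §1 **`mem_range_classBaseChange_iff`** — `H⁰(G, C_E) = C_F` as an iff: a class is `G`-fixed iff it lies in
  the range of `ι = classBaseChange F E : C_F → C_E` (Tate §8 Prop. 8.1 "`C_K → C_L^G` is bijective"; Neukirch
  III (2.7); ← is the Galois descent `exists_classBaseChange_eq_of_forall_classGalAct_eq`).
* §2 **`index_range_classRelNorm`** — `[C_F : N_{E/F} C_E] = [E : F]` for `E/F` CYCLIC (the idelic norm index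
  equality `[𝕀_F : Fˣ N 𝕀_E] = [E:F]`, `index_normGroup_eq_finrank_of_isCyclic`, read on classes via
  `map_normGroup_eq_range_classRelNorm`); **`relIndex_range_classGalNorm`** — inside `C_E`: the norm classes
  `N̄(C_E) = ι(N_{E/F} C_E)` have relative index `[E:F]` in the fixed classes `ι(C_F)`, i.e.
  `#Ĥ⁰(G, C_E) = #(C_E^G / N_G C_E) = [E : F]` for cyclic layers — the `Ĥ⁰` (hence, by cyclic periodicity
  `H² ≅ Ĥ⁰`, the `H²`) count that axiom II of the class formation starts from.

## References

* J. W. S. Cassels, A. Fröhlich (eds.), *Algebraic Number Theory* (1967), Ch. VII (J. Tate) §5.1 Main Theorem (B),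
  §8 Prop. 8.1, §9 Thm. 9.1. [CasselsFrohlichANT1967]
* J. Neukirch, *Class Field Theory — The Bonn Lectures* (2013), Part III §2 (2.7). [Neukirch2013]
-/

noncomputable section

open NumberField
open scoped NumberField

namespace Literature.NumberTheory.Automorphic

namespace IdeleClassGroup

open Literature.NumberTheory.GaloisRepresentations

variable {F E : Type} [Field F] [Field E] [Algebra F E] [NumberField F] [NumberField E]

/-! ## §1. `H⁰(Gal(E/F), C_E) = ι(C_F)` -/

/-- **`C_E^{Gal(E/F)} = ι(C_F)`** (Tate VII §8 Prop. 8.1, Neukirch III (2.7)): an idele class of `E` is fixed by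
`Gal(E/F)` iff it is the base change of a class of `F`. [cite: CasselsFrohlichANT1967, Ch. VII §8 Prop. 8.1] -/
theorem mem_range_classBaseChange_iff [IsGalois F E] (c : IdeleClassGroup E) :
    c ∈ (classBaseChange F E).range ↔ ∀ g : E ≃ₐ[F] E, classGalAct g c = c := by
  constructor
  · rintro ⟨a, rfl⟩ g
    exact classGalAct_classBaseChange g a
  · intro hc
    obtain ⟨a, ha⟩ := exists_classBaseChange_eq_of_forall_classGalAct_eq c hc
    exact ⟨a, ha⟩

/-! ## §2. The norm index on classes -/

/-- **`[C_F : N_{E/F} C_E] = [E : F]` for a cyclic extension of number fields** (the norm index equality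
`[𝕀_F : Fˣ N_{E/F} 𝕀_E] = [E:F]` read on idele classes: `Fˣ N 𝕀_E ⊇ Fˣ = ker (𝕀_F → C_F)` and its image is
`N_{E/F}(C_E)`). [cite: CasselsFrohlichANT1967, Ch. VII §5.1 Main Theorem (B)] -/
theorem index_range_classRelNorm [IsGalois F E] [IsCyclic (E ≃ₐ[F] E)] :
    (classRelNorm F E).range.index = Module.finrank F E := by
  rw [← map_normGroup_eq_range_classRelNorm, Subgroup.index_map_eq _ (QuotientGroup.mk'_surjective _)
    (by rw [QuotientGroup.ker_mk']; exact principalIdeles_le_normGroup F E)]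
  exact index_normGroup_eq_finrank_of_isCyclic

/-- The Galois norm on classes factors through `C_F`: `N̄ = ι ∘ N_{E/F}` (`classBaseChange_classRelNorm`), so
`N̄(C_E) = ι(N_{E/F} C_E)`. [cite: CasselsFrohlichANT1967, Ch. VII §8] -/
theorem range_classGalNorm_eq_map [IsGalois F E] :
    (classGalNorm F E).range = (classRelNorm F E).range.map (classBaseChange F E) := by
  have h : classGalNorm F E = (classBaseChange F E).comp (classRelNorm F E) :=
    MonoidHom.ext fun c => (classBaseChange_classRelNorm F E c).symm
  rw [h, MonoidHom.range_comp]

/-- **`#Ĥ⁰(Gal(E/F), C_E) = [E : F]` for a cyclic extension of number fields, on classes**: inside `C_E` the norm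
classes `N̄(C_E)` have relative index `[E:F]` in the `Gal(E/F)`-fixed classes `ι(C_F) = C_E^G`
(`mem_range_classBaseChange_iff`), since `ι` is injective (`classBaseChange_injective`) and
`[C_F : N_{E/F} C_E] = [E:F]` (`index_range_classRelNorm`). [cite: CasselsFrohlichANT1967, Ch. VII §9 Thm. 9.1 (proof, Step 2)] -/
theorem relIndex_range_classGalNorm [IsGalois F E] [IsCyclic (E ≃ₐ[F] E)] :
    (classGalNorm F E).range.relIndex (classBaseChange F E).range = Module.finrank F E := by
  rw [range_classGalNorm_eq_map, MonoidHom.range_eq_map (classBaseChange F E),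
    Subgroup.relIndex_map_map_of_injective _ _ (classBaseChange_injective F E), Subgroup.relIndex_top_right,
    index_range_classRelNorm]

end IdeleClassGroup

end Literature.NumberTheory.Automorphic

end
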